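import Summits.QuantumFields.BalabanUV.Beta.GAN24.LayerLetterFaces
import Summits.QuantumFields.BalabanUV.Beta.GAN24.WardResidualSUnroll

/-!
# `BalabanUV.Beta.GAN24.LayerLetterUnion` — binder row G-an2-4 ∕ (CONV-C), W-slot CT-W, route «WC-TL» ∕ (Q-R) «QR-LL», row (LAY), programme
# «(LAY-LIT) THE LITERAL's LETTER PROFILE ROWS `hS ∧ hω` OF THE (Q-R) END», PART 6a (geometry of the END adapter):
# **THE FINE UNION OF A LABEL BOX IS THE DILATED BLOCK, AND ITS BOUNDARY LAYER LIES IN THE BLOCK's EXIT ∕ ENTRY FACES** — so the face weight `FW_U` of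
# PARTs 1–5 is dominated by leaf-01's ∕ the END's face sum at blocking `L = N·M` and block label `y` (G-an2-4 formalisation swarm → CRUX TEAM (2), leaf
# prover `b2b-balaban-gan24-formalise-leaf-03`, gen 61; INTENT 6, journal `CLAIMS.log`; names PROVISIONAL)

NOT IN PRINT; OUR BOOKKEEPING ([folklore] finite-set bookkeeping on `ℤ^{d+1}`: the box-nesting bijection of p2 g37's `WardResidualSUnroll.sum_box_mul` as a `Finset`
identity, two face inclusions, one `sum_le_sum_of_subset`; generic `d`; 0 `def`, 0 cited facts, 0 `def … : Prop`, 0 sorry).  HONEST FRAMING (cell contract, verbatim):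
«discharging `BetaPertH` makes Bałaban's UV stability UNCONDITIONAL — a real constructive-QFT result; it is NOT the continuum limit and NOT the Clay problem.»  HONEST
DEPENDENCY (verbatim): «continuum YM on T⁴ ⇐ BetaPertH ∧ nine spine estimates (0/9 proved); BetaPertH ⇐ (D1) ∧ (D4) ∧ CAP+tail; G-an2-4 gates asym, D1 and NE2/3/4.»

## Why (journal W-leaf03-g61-1, the located lattice reading)
The letter `σ m Y′` has its LABEL one lattice COARSER than its SLOT and is supported at slots near the FINE block `N•Y′ + box N` of its label; so the super-block sum
over a label box `T = M•y + box M` is supported near the boundary of the FINE UNION `U = ⋃_{Y′∈T} (N•Y′ + box N) = L•y + box L`, `L = N·M` (§1) — the block whose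
exit ∕ entry faces leaf-01's (LT-3) cell `LayerTransportBiLoc.biLoc_cubic_push₃_layer_three_weight` displays; PARTs 1–5's face weight `FW_U` is read in that currency (§2–§4).
* §1 `toSite_update_succ`, **`biUnion_box_image_eq`** — `((box M).image (w ↦ M•y + toSite w)).biUnion (Y′ ↦ (box N).image (v ↦ N•Y′ + toSite v))
  = (box (N·M)).image (s ↦ (N·M)•y + toSite s)` (`1 ≤ N`).
* §2 **`sdiff_shift_subset_exitFace`** (`B ∖ (B − e_μ) ⊆` the exit face image), **`shift_sdiff_subset_entryFace`** (`(B − e_μ) ∖ B ⊆` the entry face image `− e_μ`)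
  for a block image `B = (box L).image (v ↦ L•y + toSite v)`, `1 ≤ L`.
* §3 **`faceW_block_le`** — `FW_B^r(q) ≤ Σ_μ (Σ_{exit face} e^{−r‖v−q‖₁} + Σ_{entry face − e_μ} e^{−r‖v−q‖₁})` (leaf-01's ∕ the END's face sum at `(L, y)`);
  **`faceW_union_le`** — the same for the fine union of the label box `M•y + box M` at block side `N`, read at blocking `N·M`.
PART 6b (`LayerLetterEnd`) feeds `W :=` that face sum into PART 5's `biLoc_sum_psi_of_faceW` and threads the `G`-sandwich, `mmRead`, the scalar and `unitS`.
DISCHARGES NO ROW: no object of an2's typed system occurs; (LAY)'s literal rows, (LT), K-LL-4, the (S) row, the END and (Q-R) are NOT here; 0 estimate of Bałaban's;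
NOTHING of (Q-R) ∕ (LT) ∕ (Q-L) ∕ (C) ∕ (S) ∕ «T2Shape» ∕ «T2Drift» ∕ (hW, hWall) discharged; NEVER «G-an2-4 closed» as (CONV-C); NOT D1, NOT `BetaPertH`, NOT continuum, NOT Clay.
2026-08-22.
-/

namespace Summit.QuantumFields.BalabanUV.Beta.GAN24.LayerLetterUnion

open Finset
open scoped BigOperators
open Literature.MathematicalPhysics.QuantumFieldTheory
open Literature.MathematicalPhysics.QuantumFieldTheory.Balaban1983to89
open Literature.MathematicalPhysics.QuantumFieldTheory.Balaban1983to89.Beta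
open Literature.MathematicalPhysics.QuantumFieldTheory.Balaban1983to89.B12Sec2to5 (l1 l1_nonneg)
open B6BondElimination (unitVec unitVec_apply)
open ExpKernelCalculus (Site)
open AffineAveraging (box toSite)
open AxialProjector (toSite_injective)
open Summit.QuantumFields.BalabanUV.Beta.GAN24.WardResidualSUnroll (mem_box_iff)
open Summit.QuantumFields.BalabanUV.Beta.GAN24.BlockDivergenceFlux (toSite_update_pred)
open Summit.QuantumFields.BalabanUV.Beta.GAN24.LayerLetterFaces (faceW_nonneg)

variable {d : ℕ}

/-! ## §1 The fine union of a label box is the dilated block -/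

/-- [folklore] Raising the `μ`-th offset by one is the lattice translation by `+e_μ`. -/
theorem toSite_update_succ (v : Fin (d + 1) → ℕ) (μ : Fin (d + 1)) :
    toSite (Function.update v μ (v μ + 1)) = toSite v + unitVec μ := by
  funext i
  simp only [toSite, Pi.add_apply, unitVec_apply]
  by_cases hi : i = μ
  · subst hi
    rw [Function.update_self, if_pos rfl, Nat.cast_add, Nat.cast_one]
  · rw [Function.update_of_ne hi, if_neg hi, add_zero]

/-- [folklore] **THE FINE UNION OF A LABEL BOX IS THE DILATED BLOCK** (the box-nesting bijection `(w, v) ↦ N•w + v` of p2's `WardResidualSUnroll.sum_box_mul` as a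
`Finset` identity, `1 ≤ N`): `⋃_{Y′ ∈ M•y + box M} (N•Y′ + box N) = (N·M)•y + box (N·M)`. -/
theorem biUnion_box_image_eq {N : ℕ} (hN : 1 ≤ N) (M : ℕ) (y : Site (d + 1)) :
    ((box (d + 1) M).image (fun w => (M : ℤ) • y + toSite w)).biUnion (fun Y' => (box (d + 1) N).image (fun v => (N : ℤ) • Y' + toSite v))
      = (box (d + 1) (N * M)).image (fun s => ((N * M : ℕ) : ℤ) • y + toSite s) := by
  classical
  ext x
  simp only [Finset.mem_biUnion, Finset.mem_image]
  constructor
  · rintro ⟨Y', ⟨w, hw, rfl⟩, v, hv, rfl⟩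
    refine ⟨fun i => N * w i + v i, ?_, ?_⟩
    · rw [mem_box_iff]
      intro i
      have h1 := (mem_box_iff.mp hw) i
      have h2 := (mem_box_iff.mp hv) i
      calc N * w i + v i < N * w i + N := by omega
        _ = N * (w i + 1) := by ring
        _ ≤ N * M := Nat.mul_le_mul_left N h1
    · funext i
      simp only [toSite, Pi.add_apply, Pi.smul_apply, smul_eq_mul, Nat.cast_add, Nat.cast_mul]
      ring
  · rintro ⟨s, hs, rfl⟩
    have hs' := mem_box_iff.mp hs
    refine ⟨(M : ℤ) • y + toSite (fun i => s i / N), ⟨fun i => s i / N, ?_, rfl⟩, fun i => s i % N, ?_, ?_⟩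
    · rw [mem_box_iff]
      intro i
      exact Nat.div_lt_of_lt_mul (by simpa [Nat.mul_comm] using hs' i)
    · rw [mem_box_iff]
      intro i
      exact Nat.mod_lt _ hN
    · funext i
      simp only [toSite, Pi.add_apply, Pi.smul_apply, smul_eq_mul, Nat.cast_mul]
      have h := Nat.div_add_mod (s i) N
      have h' : ((s i : ℕ) : ℤ) = (N : ℤ) * ((s i / N : ℕ) : ℤ) + ((s i % N : ℕ) : ℤ) := by exact_mod_cast h.symm
      rw [h']
      ring

/-! ## §2 The boundary layer of a block image lies in its exit ∕ entry faces -/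

/-- [folklore] **INNER FACES ARE EXIT FACES**: for the block image `B = (box L).image (v ↦ L•y + toSite v)`, the inner `μ`-face `B ∖ (B − e_μ)`
(`= {x ∈ B : x + e_μ ∉ B}`) is contained in the image of the exit face `{v ∈ box L : v μ = L − 1}`. -/
theorem sdiff_shift_subset_exitFace (L : ℕ) (y : Site (d + 1)) (μ : Fin (d + 1)) :
    (box (d + 1) L).image (fun v => (L : ℤ) • y + toSite v)
        \ ((box (d + 1) L).image (fun v => (L : ℤ) • y + toSite v)).image (fun x => x - unitVec μ)
      ⊆ ((box (d + 1) L).filter (fun v => v μ = L - 1)).image (fun v => (L : ℤ) • y + toSite v) := by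
  classical
  intro x hx
  rw [Finset.mem_sdiff] at hx
  obtain ⟨hxB, hxn⟩ := hx
  obtain ⟨s, hs, rfl⟩ := Finset.mem_image.1 hxB
  have hs' := mem_box_iff.mp hs
  refine Finset.mem_image.2 ⟨s, Finset.mem_filter.2 ⟨hs, ?_⟩, rfl⟩
  by_contra hne
  apply hxn
  have hlt : s μ + 1 < L := by have := hs' μ; omega
  refine Finset.mem_image.2 ⟨(L : ℤ) • y + toSite (Function.update s μ (s μ + 1)), Finset.mem_image.2 ⟨_, ?_, rfl⟩, ?_⟩
  · rw [mem_box_iff]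
    intro i
    by_cases hi : i = μ
    · subst hi; rw [Function.update_self]; exact hlt
    · rw [Function.update_of_ne hi]; exact hs' i
  · rw [toSite_update_succ]; abel

/-- [folklore] **OUTER FACES ARE ENTRY FACES**: for the block image `B`, the outer `μ`-face `(B − e_μ) ∖ B` (`= {x ∉ B : x + e_μ ∈ B}`) is contained in the image of
the entry face `{v ∈ box L : v μ = 0}` translated by `−e_μ`. -/
theorem shift_sdiff_subset_entryFace (L : ℕ) (y : Site (d + 1)) (μ : Fin (d + 1)) :
    ((box (d + 1) L).image (fun v => (L : ℤ) • y + toSite v)).image (fun x => x - unitVec μ)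
        \ (box (d + 1) L).image (fun v => (L : ℤ) • y + toSite v)
      ⊆ ((box (d + 1) L).filter (fun v => v μ = 0)).image (fun v => (L : ℤ) • y + toSite v - unitVec μ) := by
  classical
  intro x hx
  rw [Finset.mem_sdiff] at hx
  obtain ⟨hxI, hxn⟩ := hx
  obtain ⟨x', hx', rfl⟩ := Finset.mem_image.1 hxI
  obtain ⟨s, hs, rfl⟩ := Finset.mem_image.1 hx'
  have hs' := mem_box_iff.mp hs
  refine Finset.mem_image.2 ⟨s, Finset.mem_filter.2 ⟨hs, ?_⟩, rfl⟩
  by_contra hne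
  apply hxn
  have h1 : 1 ≤ s μ := by omega
  refine Finset.mem_image.2 ⟨Function.update s μ (s μ - 1), ?_, ?_⟩
  · rw [mem_box_iff]
    intro i
    by_cases hi : i = μ
    · subst hi; rw [Function.update_self]; have := hs' i; omega
    · rw [Function.update_of_ne hi]; exact hs' i
  · rw [toSite_update_pred s μ h1]; abel

/-! ## §3 The face weight of a block image is dominated by the exit ∕ entry face sum -/

/-- [folklore] **THE FACE WEIGHT OF A BLOCK IS AT MOST leaf-01's ∕ THE END's FACE SUM**: for `B = (box L).image (v ↦ L•y + toSite v)`, any rate `r` and anchor `q`,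
`FW_B^r(q) ≤ Σ_μ (Σ_{v ∈ exit face} e^{−r‖v−q‖₁} + Σ_{v ∈ entry face − e_μ} e^{−r‖v−q‖₁})` (§2 + `sum_le_sum_of_subset_of_nonneg`; in fact an equality, not needed). -/
theorem faceW_block_le (L : ℕ) (y : Site (d + 1)) (r : ℝ) (q : Site (d + 1)) :
    (∑ μ : Fin (d + 1),
      (∑ w' ∈ ((box (d + 1) L).image (fun v => (L : ℤ) • y + toSite v)).image (fun x => x - unitVec μ)
              \ (box (d + 1) L).image (fun v => (L : ℤ) • y + toSite v), Real.exp (-r * l1 (w' - q))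
        + ∑ w' ∈ (box (d + 1) L).image (fun v => (L : ℤ) • y + toSite v)
              \ ((box (d + 1) L).image (fun v => (L : ℤ) • y + toSite v)).image (fun x => x - unitVec μ), Real.exp (-r * l1 (w' - q))))
      ≤ ∑ μ : Fin (d + 1),
        (∑ v ∈ ((box (d + 1) L).filter (fun v => v μ = L - 1)).image (fun v => (L : ℤ) • y + toSite v), Real.exp (-r * l1 (v - q))
          + ∑ v ∈ ((box (d + 1) L).filter (fun v => v μ = 0)).image (fun v => (L : ℤ) • y + toSite v - unitVec μ),
              Real.exp (-r * l1 (v - q))) := by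
  classical
  refine Finset.sum_le_sum fun μ _ => ?_
  rw [add_comm]
  exact add_le_add
    (Finset.sum_le_sum_of_subset_of_nonneg (sdiff_shift_subset_exitFace L y μ) fun _ _ _ => (Real.exp_pos _).le)
    (Finset.sum_le_sum_of_subset_of_nonneg (shift_sdiff_subset_entryFace L y μ) fun _ _ _ => (Real.exp_pos _).le)

/-- [folklore] **THE FACE WEIGHT OF THE FINE UNION OF A LABEL BOX IS AT MOST THE FACE SUM OF THE DILATED BLOCK** (§1 ⨾ §3): for the label box
`T = (box M).image (w ↦ M•y + toSite w)` with blocks of side `N ≥ 1`, the fine union `U = T.biUnion (Y′ ↦ (box N).image (v ↦ N•Y′ + toSite v))` has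
`FW_U^r(q) ≤` leaf-01's ∕ the END's face sum at blocking `N·M` and label `y`. -/
theorem faceW_union_le {N : ℕ} (hN : 1 ≤ N) (M : ℕ) (y : Site (d + 1)) (r : ℝ) (q : Site (d + 1)) :
    (∑ μ : Fin (d + 1),
      (∑ w' ∈ (((box (d + 1) M).image (fun w => (M : ℤ) • y + toSite w)).biUnion
                  (fun Y' => (box (d + 1) N).image (fun v => (N : ℤ) • Y' + toSite v))).image (fun x => x - unitVec μ)
              \ ((box (d + 1) M).image (fun w => (M : ℤ) • y + toSite w)).biUnion
                  (fun Y' => (box (d + 1) N).image (fun v => (N : ℤ) • Y' + toSite v)), Real.exp (-r * l1 (w' - q))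
        + ∑ w' ∈ ((box (d + 1) M).image (fun w => (M : ℤ) • y + toSite w)).biUnion
                  (fun Y' => (box (d + 1) N).image (fun v => (N : ℤ) • Y' + toSite v))
              \ (((box (d + 1) M).image (fun w => (M : ℤ) • y + toSite w)).biUnion
                  (fun Y' => (box (d + 1) N).image (fun v => (N : ℤ) • Y' + toSite v))).image (fun x => x - unitVec μ),
            Real.exp (-r * l1 (w' - q))))
      ≤ ∑ μ : Fin (d + 1),
        (∑ v ∈ ((box (d + 1) (N * M)).filter (fun v => v μ = N * M - 1)).image (fun v => ((N * M : ℕ) : ℤ) • y + toSite v),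
            Real.exp (-r * l1 (v - q))
          + ∑ v ∈ ((box (d + 1) (N * M)).filter (fun v => v μ = 0)).image (fun v => ((N * M : ℕ) : ℤ) • y + toSite v - unitVec μ),
              Real.exp (-r * l1 (v - q))) := by
  rw [biUnion_box_image_eq hN M y]
  exact faceW_block_le (N * M) y r q

/-! ## §4 One dilation: fine faces of the dilated block against the coarse faces (the count `|box N|·e^{r(d+2)N}`) -/

/-- [folklore] THE QUOTIENT ∕ REMAINDER DECOMPOSITION of a fine site of the dilated block: `(N·L)•y + toSite s = N•(L•y + toSite (s ∕ N)) + toSite (s % N)`. -/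
theorem dilate_decomp (N L : ℕ) (y : Site (d + 1)) (s : Fin (d + 1) → ℕ) :
    ((N * L : ℕ) : ℤ) • y + toSite s = (N : ℤ) • ((L : ℤ) • y + toSite (fun i => s i / N)) + toSite (fun i => s i % N) := by
  funext i
  simp only [toSite, Pi.add_apply, Pi.smul_apply, smul_eq_mul, Nat.cast_mul]
  have h' : ((s i : ℕ) : ℤ) = (N : ℤ) * ((s i / N : ℕ) : ℤ) + ((s i % N : ℕ) : ℤ) := by exact_mod_cast (Nat.div_add_mod (s i) N).symm
  rw [h']
  ring

/-- [folklore] `‖toSite (s % N)‖₁ ≤ (d+1)·N` (`1 ≤ N`). -/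
theorem l1_toSite_mod_le {N : ℕ} (hN : 1 ≤ N) (s : Fin (d + 1) → ℕ) : l1 (toSite (fun i => s i % N)) ≤ ((d : ℝ) + 1) * N := by
  unfold l1
  have hterm : ∀ i : Fin (d + 1), |((toSite (fun i => s i % N) i : ℤ) : ℝ)| ≤ (N : ℝ) := by
    intro i
    simp only [toSite, Int.cast_natCast, Nat.abs_cast]
    exact_mod_cast (Nat.mod_lt (s i) hN).le
  calc ∑ i : Fin (d + 1), |((toSite (fun i => s i % N) i : ℤ) : ℝ)| ≤ ∑ _i : Fin (d + 1), (N : ℝ) := Finset.sum_le_sum fun i _ => hterm i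
    _ = ((d : ℝ) + 1) * N := by rw [Finset.sum_const, Finset.card_univ, Fintype.card_fin, nsmul_eq_mul]; push_cast; ring

/-- [folklore] THE DILATED EXPONENTIAL: `e^{−r‖N•w + b‖₁} ≤ e^{r·B}·e^{−r‖w‖₁}` whenever `‖b‖₁ ≤ B`, `1 ≤ N`, `0 ≤ r`. -/
theorem exp_dilate_le {N : ℕ} (hN : 1 ≤ N) {r B : ℝ} (hr : 0 ≤ r) (w b : Site (d + 1)) (hb : l1 b ≤ B) :
    Real.exp (-r * l1 ((N : ℤ) • w + b)) ≤ Real.exp (r * B) * Real.exp (-r * l1 w) := by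
  have hNw : l1 ((N : ℤ) • w) = (N : ℝ) * l1 w := ExpKernelCalculus.l1_natSmul N w
  have hN1 : (1 : ℝ) ≤ (N : ℝ) := by exact_mod_cast hN
  have hw0 := l1_nonneg w
  have htri : l1 ((N : ℤ) • w + b - b) ≤ l1 ((N : ℤ) • w + b - 0) + l1 ((0 : Site (d + 1)) - b) := ExpKernelCalculus.l1_sub_triangle _ 0 b
  rw [add_sub_cancel_right, sub_zero, zero_sub] at htri
  have hneg : l1 (-b) = l1 b := by unfold l1; simp
  rw [hneg, hNw] at htri
  have h2 : l1 w - B ≤ l1 ((N : ℤ) • w + b) := by nlinarith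
  rw [← Real.exp_add, Real.exp_le_exp]
  nlinarith [mul_le_mul_of_nonneg_left h2 hr]

/-- [folklore] **THE COUNT OF ONE DILATION**: summing a nonnegative function of the quotient `s ∕ N` over a finite set of fine offsets costs at most `|box N|` per coarse offset:
`Σ_{s∈S} h (s ∕ N) ≤ |box N| · Σ_{t ∈ S.image (· ∕ N)} h t` (the fibres of `s ↦ s ∕ N` inject into `box N` by `s ↦ s % N`). -/
theorem sum_div_fiber_le {N : ℕ} (hN : 1 ≤ N) (S : Finset (Fin (d + 1) → ℕ)) (h : (Fin (d + 1) → ℕ) → ℝ) (hh : ∀ t, 0 ≤ h t) :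
    ∑ s ∈ S, h (fun i => s i / N) ≤ ((box (d + 1) N).card : ℝ) * ∑ t ∈ S.image (fun s => fun i => s i / N), h t := by
  classical
  have hmaps : ∀ s ∈ S, (fun i => s i / N) ∈ S.image (fun s => fun i => s i / N) := fun s hs => Finset.mem_image_of_mem _ hs
  rw [← Finset.sum_fiberwise_of_maps_to hmaps, Finset.mul_sum]
  refine Finset.sum_le_sum fun t _ => ?_
  have hfib : ∑ s ∈ S.filter (fun s => (fun i => s i / N) = t), h (fun i => s i / N)
      = ((S.filter (fun s => (fun i => s i / N) = t)).card : ℝ) * h t := by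
    rw [Finset.sum_congr rfl (fun s hs => by rw [(Finset.mem_filter.1 hs).2]), Finset.sum_const, nsmul_eq_mul]
  rw [hfib]
  refine mul_le_mul_of_nonneg_right ?_ (hh t)
  have hcard : (S.filter (fun s => (fun i => s i / N) = t)).card ≤ (box (d + 1) N).card := by
    refine Finset.card_le_card_of_injOn (fun s => fun i => s i % N) (fun s _ => ?_) ?_
    · exact Finset.mem_coe.2 (mem_box_iff.2 fun i => Nat.mod_lt _ hN)
    · intro s₁ hs₁ s₂ hs₂ heq
      have h1 := (Finset.mem_filter.1 (Finset.mem_coe.1 hs₁)).2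
      have h2 := (Finset.mem_filter.1 (Finset.mem_coe.1 hs₂)).2
      funext i
      have q1 := congr_fun h1 i
      have q2 := congr_fun h2 i
      have m := congr_fun heq i
      simp only at q1 q2 m
      rw [← Nat.div_add_mod (s₁ i) N, ← Nat.div_add_mod (s₂ i) N, q1, q2, m]
  exact_mod_cast hcard

/-- [folklore] **EXIT FACES, ONE DILATION**: the exit `μ`-face of the dilated block `(N·L)•y + box (N·L)` read at `N•u′` is dominated by `|box N|·e^{r(d+2)N}` times the
exit `μ`-face of `L•y + box L` read at `u′` (`1 ≤ N`, `0 ≤ r`). -/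
theorem exitFace_dilate_le {N : ℕ} (hN : 1 ≤ N) (L : ℕ) (y : Site (d + 1)) {r : ℝ} (hr : 0 ≤ r) (u' : Site (d + 1)) (μ : Fin (d + 1)) :
    (∑ f ∈ ((box (d + 1) (N * L)).filter (fun s => s μ = N * L - 1)).image (fun s => ((N * L : ℕ) : ℤ) • y + toSite s),
        Real.exp (-r * l1 (f - (N : ℤ) • u')))
      ≤ ((box (d + 1) N).card : ℝ) * Real.exp (r * (((d : ℝ) + 2) * N))
        * ∑ v ∈ ((box (d + 1) L).filter (fun t => t μ = L - 1)).image (fun t => (L : ℤ) • y + toSite t), Real.exp (-r * l1 (v - u')) := by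
  classical
  rw [Finset.sum_image (fun s _ s' _ h => toSite_injective (add_left_cancel h)),
    Finset.sum_image (fun t _ t' _ h => toSite_injective (add_left_cancel h))]
  set S := (box (d + 1) (N * L)).filter (fun s => s μ = N * L - 1) with hS
  have hcnt := sum_div_fiber_le hN S (fun t => Real.exp (-r * l1 ((L : ℤ) • y + toSite t - u'))) (fun _ => (Real.exp_pos _).le)
  have hterm : ∀ s ∈ S, Real.exp (-r * l1 (((N * L : ℕ) : ℤ) • y + toSite s - (N : ℤ) • u'))
      ≤ Real.exp (r * (((d : ℝ) + 2) * N)) * Real.exp (-r * l1 ((L : ℤ) • y + toSite (fun i => s i / N) - u')) := by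
    intro s _
    have e : ((N * L : ℕ) : ℤ) • y + toSite s - (N : ℤ) • u'
        = (N : ℤ) • ((L : ℤ) • y + toSite (fun i => s i / N) - u') + toSite (fun i => s i % N) := by
      rw [dilate_decomp N L y s, smul_sub]; abel
    rw [e]
    refine exp_dilate_le hN hr _ _ ((l1_toSite_mod_le hN s).trans ?_)
    have : (0 : ℝ) ≤ N := Nat.cast_nonneg N
    nlinarith
  have himg : S.image (fun s => fun i => s i / N) ⊆ (box (d + 1) L).filter (fun t => t μ = L - 1) := by
    intro t ht
    obtain ⟨s, hs, rfl⟩ := Finset.mem_image.1 ht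
    obtain ⟨hsb, hsμ⟩ := Finset.mem_filter.1 hs
    have hsb' := mem_box_iff.1 hsb
    refine Finset.mem_filter.2 ⟨mem_box_iff.2 fun i => Nat.div_lt_of_lt_mul (by simpa [Nat.mul_comm] using hsb' i), ?_⟩
    show s μ / N = L - 1
    have hlt : s μ / N < L := Nat.div_lt_of_lt_mul (by simpa [Nat.mul_comm] using hsb' μ)
    have hge : L - 1 ≤ s μ / N := by
      rw [Nat.le_div_iff_mul_le hN]
      have := hsb' μ
      rcases Nat.eq_zero_or_pos L with hL | hL
      · simp [hL]
      · have : (L - 1) * N = N * L - N := by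
          rw [Nat.mul_comm, Nat.mul_sub_one]
        omega
    omega
  calc ∑ s ∈ S, Real.exp (-r * l1 (((N * L : ℕ) : ℤ) • y + toSite s - (N : ℤ) • u'))
      ≤ ∑ s ∈ S, Real.exp (r * (((d : ℝ) + 2) * N)) * Real.exp (-r * l1 ((L : ℤ) • y + toSite (fun i => s i / N) - u')) :=
        Finset.sum_le_sum hterm
    _ = Real.exp (r * (((d : ℝ) + 2) * N)) * ∑ s ∈ S, Real.exp (-r * l1 ((L : ℤ) • y + toSite (fun i => s i / N) - u')) := by
        rw [Finset.mul_sum]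
    _ ≤ Real.exp (r * (((d : ℝ) + 2) * N)) * (((box (d + 1) N).card : ℝ)
          * ∑ t ∈ S.image (fun s => fun i => s i / N), Real.exp (-r * l1 ((L : ℤ) • y + toSite t - u'))) :=
        mul_le_mul_of_nonneg_left hcnt (Real.exp_pos _).le
    _ ≤ Real.exp (r * (((d : ℝ) + 2) * N)) * (((box (d + 1) N).card : ℝ)
          * ∑ t ∈ (box (d + 1) L).filter (fun t => t μ = L - 1), Real.exp (-r * l1 ((L : ℤ) • y + toSite t - u'))) :=
        mul_le_mul_of_nonneg_left (mul_le_mul_of_nonneg_left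
          (Finset.sum_le_sum_of_subset_of_nonneg himg fun _ _ _ => (Real.exp_pos _).le) (Nat.cast_nonneg _)) (Real.exp_pos _).le
    _ = _ := by ring

/-- [folklore] **ENTRY FACES, ONE DILATION**: the same for the entry `μ`-faces (translated by `−e_μ`): the remainder vector is `toSite (s % N) + (N−1)•e_μ`,
`‖·‖₁ ≤ (d+2)N`. -/
theorem entryFace_dilate_le {N : ℕ} (hN : 1 ≤ N) (L : ℕ) (y : Site (d + 1)) {r : ℝ} (hr : 0 ≤ r) (u' : Site (d + 1)) (μ : Fin (d + 1)) :
    (∑ f ∈ ((box (d + 1) (N * L)).filter (fun s => s μ = 0)).image (fun s => ((N * L : ℕ) : ℤ) • y + toSite s - unitVec μ),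
        Real.exp (-r * l1 (f - (N : ℤ) • u')))
      ≤ ((box (d + 1) N).card : ℝ) * Real.exp (r * (((d : ℝ) + 2) * N))
        * ∑ v ∈ ((box (d + 1) L).filter (fun t => t μ = 0)).image (fun t => (L : ℤ) • y + toSite t - unitVec μ), Real.exp (-r * l1 (v - u')) := by
  classical
  rw [Finset.sum_image (fun s _ s' _ h => toSite_injective (add_left_cancel (sub_left_injective h))),
    Finset.sum_image (fun t _ t' _ h => toSite_injective (add_left_cancel (sub_left_injective h)))]
  set S := (box (d + 1) (N * L)).filter (fun s => s μ = 0) with hS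
  have hcnt := sum_div_fiber_le hN S (fun t => Real.exp (-r * l1 ((L : ℤ) • y + toSite t - unitVec μ - u'))) (fun _ => (Real.exp_pos _).le)
  have hunit : l1 (((N : ℤ) - 1) • (unitVec μ : Site (d + 1))) ≤ (N : ℝ) := by
    unfold l1
    have hterm : ∀ i : Fin (d + 1), |(((((N : ℤ) - 1) • (unitVec μ : Site (d + 1))) i : ℤ) : ℝ)| ≤ if i = μ then (N : ℝ) else 0 := by
      intro i
      simp only [Pi.smul_apply, unitVec_apply, smul_eq_mul]
      by_cases hi : i = μ
      · rw [if_pos hi, if_pos hi, mul_one]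
        have hN1 : (1 : ℤ) ≤ N := by exact_mod_cast hN
        rw [show (((N : ℤ) - 1 : ℤ) : ℝ) = (N : ℝ) - 1 by push_cast; ring, abs_of_nonneg (by
          have : (1 : ℝ) ≤ N := by exact_mod_cast hN
          linarith)]
        linarith
      · rw [if_neg hi, if_neg hi, mul_zero]; simp
    calc ∑ i : Fin (d + 1), |(((((N : ℤ) - 1) • (unitVec μ : Site (d + 1))) i : ℤ) : ℝ)| ≤ ∑ i : Fin (d + 1), (if i = μ then (N : ℝ) else 0) :=
          Finset.sum_le_sum fun i _ => hterm i
      _ = N := by rw [Finset.sum_ite_eq' Finset.univ μ, if_pos (Finset.mem_univ μ)]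
  have hterm : ∀ s ∈ S, Real.exp (-r * l1 (((N * L : ℕ) : ℤ) • y + toSite s - unitVec μ - (N : ℤ) • u'))
      ≤ Real.exp (r * (((d : ℝ) + 2) * N)) * Real.exp (-r * l1 ((L : ℤ) • y + toSite (fun i => s i / N) - unitVec μ - u')) := by
    intro s _
    have e : ((N * L : ℕ) : ℤ) • y + toSite s - unitVec μ - (N : ℤ) • u'
        = (N : ℤ) • ((L : ℤ) • y + toSite (fun i => s i / N) - unitVec μ - u')
          + (toSite (fun i => s i % N) + ((N : ℤ) - 1) • (unitVec μ : Site (d + 1))) := by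
      rw [dilate_decomp N L y s, smul_sub, smul_sub, sub_smul, one_smul]
      abel
    rw [e]
    refine exp_dilate_le hN hr _ _ ?_
    have htri : l1 (toSite (fun i => s i % N) + ((N : ℤ) - 1) • (unitVec μ : Site (d + 1)))
        ≤ l1 (toSite (fun i => s i % N)) + l1 (((N : ℤ) - 1) • (unitVec μ : Site (d + 1))) := by
      have h := ExpKernelCalculus.l1_sub_triangle (toSite (fun i => s i % N) + ((N : ℤ) - 1) • (unitVec μ : Site (d + 1)))
        (((N : ℤ) - 1) • (unitVec μ : Site (d + 1))) 0
      rw [sub_zero, sub_zero, add_sub_cancel_right] at h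
      exact h
    have h1 := l1_toSite_mod_le hN s
    have : (0 : ℝ) ≤ N := Nat.cast_nonneg N
    nlinarith
  have himg : S.image (fun s => fun i => s i / N) ⊆ (box (d + 1) L).filter (fun t => t μ = 0) := by
    intro t ht
    obtain ⟨s, hs, rfl⟩ := Finset.mem_image.1 ht
    obtain ⟨hsb, hsμ⟩ := Finset.mem_filter.1 hs
    have hsb' := mem_box_iff.1 hsb
    refine Finset.mem_filter.2 ⟨mem_box_iff.2 fun i => Nat.div_lt_of_lt_mul (by simpa [Nat.mul_comm] using hsb' i), ?_⟩
    show s μ / N = 0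
    rw [hsμ, Nat.zero_div]
  calc ∑ s ∈ S, Real.exp (-r * l1 (((N * L : ℕ) : ℤ) • y + toSite s - unitVec μ - (N : ℤ) • u'))
      ≤ ∑ s ∈ S, Real.exp (r * (((d : ℝ) + 2) * N)) * Real.exp (-r * l1 ((L : ℤ) • y + toSite (fun i => s i / N) - unitVec μ - u')) :=
        Finset.sum_le_sum hterm
    _ = Real.exp (r * (((d : ℝ) + 2) * N)) * ∑ s ∈ S, Real.exp (-r * l1 ((L : ℤ) • y + toSite (fun i => s i / N) - unitVec μ - u')) := by
        rw [Finset.mul_sum]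
    _ ≤ Real.exp (r * (((d : ℝ) + 2) * N)) * (((box (d + 1) N).card : ℝ)
          * ∑ t ∈ S.image (fun s => fun i => s i / N), Real.exp (-r * l1 ((L : ℤ) • y + toSite t - unitVec μ - u'))) :=
        mul_le_mul_of_nonneg_left hcnt (Real.exp_pos _).le
    _ ≤ Real.exp (r * (((d : ℝ) + 2) * N)) * (((box (d + 1) N).card : ℝ)
          * ∑ t ∈ (box (d + 1) L).filter (fun t => t μ = 0), Real.exp (-r * l1 ((L : ℤ) • y + toSite t - unitVec μ - u'))) :=
        mul_le_mul_of_nonneg_left (mul_le_mul_of_nonneg_left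
          (Finset.sum_le_sum_of_subset_of_nonneg himg fun _ _ _ => (Real.exp_pos _).le) (Nat.cast_nonneg _)) (Real.exp_pos _).le
    _ = _ := by ring

/-- [folklore] **THE FACE WEIGHT OF THE DILATED BLOCK AT THE DILATED ANCHOR AGAINST THE COARSE FACE SUM** (§3 ⨾ §4): for `U = (box (N·L)).image (s ↦ (N·L)•y + toSite s)`,
`FW_U^r(N•u′) ≤ |box N|·e^{r(d+2)N}·Σ_μ (Σ_{exit face of (L,y)} + Σ_{entry face of (L,y) − e_μ}) e^{−r‖v−u′‖₁}` (`1 ≤ N`, `0 ≤ r`) — the letter's face weight in the KERNEL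
lattice against leaf-01's ∕ the END's face sum in the SLOT lattice, one dilation up. -/
theorem faceW_dilate_le {N : ℕ} (hN : 1 ≤ N) (L : ℕ) (y : Site (d + 1)) {r : ℝ} (hr : 0 ≤ r) (u' : Site (d + 1)) :
    (∑ μ : Fin (d + 1),
      (∑ w' ∈ ((box (d + 1) (N * L)).image (fun s => ((N * L : ℕ) : ℤ) • y + toSite s)).image (fun x => x - unitVec μ)
              \ (box (d + 1) (N * L)).image (fun s => ((N * L : ℕ) : ℤ) • y + toSite s), Real.exp (-r * l1 (w' - (N : ℤ) • u'))
        + ∑ w' ∈ (box (d + 1) (N * L)).image (fun s => ((N * L : ℕ) : ℤ) • y + toSite s)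
              \ ((box (d + 1) (N * L)).image (fun s => ((N * L : ℕ) : ℤ) • y + toSite s)).image (fun x => x - unitVec μ),
            Real.exp (-r * l1 (w' - (N : ℤ) • u'))))
      ≤ ((box (d + 1) N).card : ℝ) * Real.exp (r * (((d : ℝ) + 2) * N))
        * ∑ μ : Fin (d + 1),
          (∑ v ∈ ((box (d + 1) L).filter (fun t => t μ = L - 1)).image (fun t => (L : ℤ) • y + toSite t), Real.exp (-r * l1 (v - u'))
            + ∑ v ∈ ((box (d + 1) L).filter (fun t => t μ = 0)).image (fun t => (L : ℤ) • y + toSite t - unitVec μ),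
                Real.exp (-r * l1 (v - u'))) := by
  refine (faceW_block_le (N * L) y r ((N : ℤ) • u')).trans ?_
  rw [Finset.mul_sum]
  refine Finset.sum_le_sum fun μ _ => ?_
  rw [mul_add]
  exact add_le_add (exitFace_dilate_le hN L y hr u' μ) (entryFace_dilate_le hN L y hr u' μ)

end Summit.QuantumFields.BalabanUV.Beta.GAN24.LayerLetterUnion
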